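import Summits.QuantumFields.YangMills.Theorems.SqueezedSkewnessMirrorDescentModulus
import Summits.QuantumFields.YangMills.Theorems.BalabanLadderNTReferenceMarginsExplicit
import HarnessLib

/-!
# Route `SqueezedSkewness`, LINE μ «slab response» (crux `BalabanLadder.NT`, stmt-QuantumFields-19353), support stub
# `stub_mirrorDescent`: torus-side floor transfer and ceiling at one coupling, packaged, and the real arithmetic of the thresholds

Packaging of `…MirrorDescentModulus` for the assembly of `stub_mirrorDescent`: at one coupling, under the `n`-point collar bound of
`MomentBounds` (constant `C`, radius `R`, `(R+2)α ≤ δ`, `6 ≤ αL`), for a bump `v` with time gap `δ` inside the ball of radius `3`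
and its small shift `u = v(· + e)` (`‖e‖ ≤ 1`):

* `floor_transfer` — `|Q2(θu, u) − Q2(θv, v)| ≤ (C/R⁴)²·2·(4⁴K₁‖e‖/α⁴)(M·9⁴/α⁴)` (`M` a sup bound, `K₁` the mean-value constant of `v`);
* `ceiling_transfer` — `Q2(θf, f) ≤ (M·9⁴/α⁴)²·(C/R⁴)²` for any `f` with the gap and the ball;
* real arithmetic: `div_le_of_le_mul_pos`, `collar_radius`, `collar_sq_le`, `modulus_arith`, `ceiling_arith`, `seam_arith`,
  `mul_le_of_le_div_succ`, `sq_le_self_of_le_one`.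

Fleet lead `ym-spine-19353-p1` g23 (`--supports stmt-QuantumFields-19353`).  HONEST FRAMING: finite-torus bookkeeping at one coupling;
`MomentBounds6` is NOT proved; no NT statement, crux, rung or mass gap follows. [folklore]
-/

set_option autoImplicit false

noncomputable section

open scoped SchwartzMap
open MeasureTheory Filter Topology
open Literature.MathematicalPhysics.QuantumFieldTheory Literature.MathematicalPhysics.QuantumLattice
open Literature.Probability.LatticeModels
open Summit.QuantumFields.YangMills.Cruxes.OSLegsFromFemtoAndGap.DlrCollarTransfer
open Summit.QuantumFields.YangMills.Cruxes.NT.Reference (sum_abs_lattice_le_sup_div tsupport_thetaTest_subset_closedBall_zero)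
open Summit.QuantumFields.YangMills.Theorems.MirrorDescentModulus

namespace Summit.QuantumFields.YangMills.Theorems.MirrorDescentPrep

/-! ## §1 Real arithmetic -/

/-- `x ≤ c·Q` with `c > 0` gives `x/c ≤ Q`. [folklore] -/
theorem div_le_of_le_mul_pos {x c Q : ℝ} (hc : 0 < c) (h : x ≤ c * Q) : x / c ≤ Q := by
  rw [div_le_iff₀ hc]; linarith

/-- `0 ≤ α ≤ 1 ⇒ α² ≤ α`. [folklore] -/
theorem sq_le_self_of_le_one {α : ℝ} (h0 : 0 ≤ α) (h1 : α ≤ 1) : α ^ 2 ≤ α := by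
  rw [sq]; exact (mul_le_mul_of_nonneg_left h1 h0).trans_eq (mul_one α)

/-- `M ≥ 0`, `η ≥ 0`, `α ≤ η/(M+1)` give `M·α ≤ η`. [folklore] -/
theorem mul_le_of_le_div_succ {M α η : ℝ} (hM : 0 ≤ M) (hη : 0 ≤ η) (hα : α ≤ η / (M + 1)) : M * α ≤ η := by
  have h1 : M * α ≤ M * (η / (M + 1)) := mul_le_mul_of_nonneg_left hα hM
  have h2 : M * (η / (M + 1)) ≤ η := by
    rw [mul_div_assoc', div_le_iff₀ (by positivity)]
    nlinarith
  linarith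

/-- The collar radius at scale `c₀`: `R = ⌊c₀/α⌋` with `0 < α ≤ c₀/2` satisfies `1 ≤ R`, `R·α ≤ c₀` and `c₀/(2α) ≤ R`. [folklore] -/
theorem collar_radius {c₀ α : ℝ} (hα : 0 < α) (hαc : α ≤ c₀ / 2) :
    1 ≤ ⌊c₀ / α⌋₊ ∧ (⌊c₀ / α⌋₊ : ℝ) * α ≤ c₀ ∧ c₀ / (2 * α) ≤ (⌊c₀ / α⌋₊ : ℝ) := by
  have hcs : 2 ≤ c₀ / α := by rw [le_div_iff₀ hα]; linarith
  have hRle : (⌊c₀ / α⌋₊ : ℝ) ≤ c₀ / α := Nat.floor_le (by positivity)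
  have hRgt : c₀ / α - 1 < (⌊c₀ / α⌋₊ : ℝ) := Nat.sub_one_lt_floor _
  refine ⟨Nat.le_floor (by rw [Nat.cast_one]; linarith), ?_, ?_⟩
  · calc (⌊c₀ / α⌋₊ : ℝ) * α ≤ c₀ / α * α := mul_le_mul_of_nonneg_right hRle hα.le
      _ = c₀ := div_mul_cancel₀ c₀ hα.ne'
  · have : c₀ / (2 * α) = c₀ / α - c₀ / α / 2 := by ring
    linarith

/-- `(C/R⁴)² ≤ 256·C²·α⁸/c₀⁸` once `c₀/(2α) ≤ R`. [folklore] -/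
theorem collar_sq_le {C c₀ α : ℝ} {R : ℕ} (hc₀ : 0 < c₀) (hα : 0 < α) (hRlow : c₀ / (2 * α) ≤ (R : ℝ)) :
    (C / (R : ℝ) ^ 4) ^ 2 ≤ 256 * C ^ 2 * α ^ 8 / c₀ ^ 8 := by
  have hq0 : 0 < c₀ / (2 * α) := by positivity
  have hR8 : (c₀ / (2 * α)) ^ 8 ≤ (R : ℝ) ^ 8 := pow_le_pow_left₀ hq0.le hRlow 8
  have e : (C / (R : ℝ) ^ 4) ^ 2 = C ^ 2 / (R : ℝ) ^ 8 := by rw [div_pow, ← pow_mul]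
  rw [e]
  calc C ^ 2 / (R : ℝ) ^ 8 ≤ C ^ 2 / (c₀ / (2 * α)) ^ 8 :=
        div_le_div_of_nonneg_left (sq_nonneg C) (pow_pos hq0 8) hR8
    _ = 256 * C ^ 2 * α ^ 8 / c₀ ^ 8 := by
        field_simp
        ring

/-- **Modulus arithmetic**: the eight powers of the spacing cancel and one power of the shift survives. [folklore] -/
theorem modulus_arith {k C c₁ α K₁ M t : ℝ} (hc₁ : 0 < c₁) (hα : 0 < α) (hK₁ : 0 ≤ K₁) (hM : 0 ≤ M)
    (hk : k ≤ 256 * C ^ 2 * α ^ 8 / c₁ ^ 8) (ht0 : 0 ≤ t) (ht : t ≤ α) :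
    k * (2 * ((4 ^ 4 * K₁ * t / α ^ 4) * (M * (2 * 3 + 3) ^ 4 / α ^ 4))) ≤
      (256 * C ^ 2 / c₁ ^ 8 * (2 * (4 ^ 4 * K₁ * (M * (2 * 3 + 3) ^ 4)))) * α := by
  have hA : 0 ≤ 2 * ((4 ^ 4 * K₁ * t / α ^ 4) * (M * (2 * 3 + 3) ^ 4 / α ^ 4)) := by positivity
  calc k * (2 * ((4 ^ 4 * K₁ * t / α ^ 4) * (M * (2 * 3 + 3) ^ 4 / α ^ 4)))
      ≤ (256 * C ^ 2 * α ^ 8 / c₁ ^ 8) * (2 * ((4 ^ 4 * K₁ * t / α ^ 4) * (M * (2 * 3 + 3) ^ 4 / α ^ 4))) :=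
        mul_le_mul_of_nonneg_right hk hA
    _ = (256 * C ^ 2 / c₁ ^ 8 * (2 * (4 ^ 4 * K₁ * (M * (2 * 3 + 3) ^ 4)))) * t := by
        field_simp
    _ ≤ (256 * C ^ 2 / c₁ ^ 8 * (2 * (4 ^ 4 * K₁ * (M * (2 * 3 + 3) ^ 4)))) * α :=
        mul_le_mul_of_nonneg_left ht (by positivity)

/-- **Ceiling arithmetic**: the eight powers of the spacing cancel. [folklore] -/
theorem ceiling_arith {k C c₁ α M : ℝ} (hc₁ : 0 < c₁) (hα : 0 < α) (hM : 0 ≤ M)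
    (hk : k ≤ 256 * C ^ 2 * α ^ 8 / c₁ ^ 8) :
    (M * (2 * 3 + 3) ^ 4 / α ^ 4) * (M * (2 * 3 + 3) ^ 4 / α ^ 4) * k ≤
      256 * C ^ 2 * (M * (2 * 3 + 3) ^ 4) ^ 2 / c₁ ^ 8 := by
  calc (M * (2 * 3 + 3) ^ 4 / α ^ 4) * (M * (2 * 3 + 3) ^ 4 / α ^ 4) * k
      ≤ (M * (2 * 3 + 3) ^ 4 / α ^ 4) * (M * (2 * 3 + 3) ^ 4 / α ^ 4) * (256 * C ^ 2 * α ^ 8 / c₁ ^ 8) :=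
        mul_le_mul_of_nonneg_left hk (by positivity)
    _ = 256 * C ^ 2 * (M * (2 * 3 + 3) ^ 4) ^ 2 / c₁ ^ 8 := by
        field_simp

/-- **Seam arithmetic**: the explicit `Drp` bound is `O(α²)`, two powers of the spacing to spare. [folklore] -/
theorem seam_arith {k C c₀ α K : ℝ} (hc₀ : 0 < c₀) (hα : 0 < α) (hα1 : α ≤ 1) (hK : 0 ≤ K)
    (hk : k ≤ 256 * C ^ 2 * α ^ 8 / c₀ ^ 8) :
    9 * k * (K / α ^ 3) * (K / α ^ 3) ≤ (9 * (256 * C ^ 2) * K ^ 2 / c₀ ^ 8) * α := by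
  have hKα : 0 ≤ K / α ^ 3 := by positivity
  calc 9 * k * (K / α ^ 3) * (K / α ^ 3) ≤ 9 * (256 * C ^ 2 * α ^ 8 / c₀ ^ 8) * (K / α ^ 3) * (K / α ^ 3) :=
        mul_le_mul_of_nonneg_right (mul_le_mul_of_nonneg_right (by linarith) hKα) hKα
    _ = (9 * (256 * C ^ 2) * K ^ 2 / c₀ ^ 8) * α ^ 2 := by
        field_simp
    _ ≤ (9 * (256 * C ^ 2) * K ^ 2 / c₀ ^ 8) * α :=
        mul_le_mul_of_nonneg_left (sq_le_self_of_le_one hα.le hα1) (by positivity)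

/-! ## §2 The torus-side floor transfer and ceiling at one coupling, packaged -/

section Torus

variable (G : Type) [Group G] [TopologicalSpace G] [IsTopologicalGroup G] [CompactSpace G]
  [MeasurableSpace G] [BorelSpace G] (r : LatticeRep G)

/-- **Floor transfer to a small shift at one coupling.**  Under the `n`-point collar bound at `(β, L, R)` with constant `C`, for a test
function `v` with time gap `δ` (`v p ≠ 0 → δ ≤ p₀`) supported in the ball of radius `3`, sup bound `M` and mean-value constant `K₁`, and
its shift `u = v(· + e)` (`‖e‖ ≤ 1`) with the same gap and ball, at spacing `0 < α ≤ 1` with `6 ≤ αL`, `(R+2)α ≤ δ`: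
`|Q2(θu, u) − Q2(θv, v)| ≤ (C/R⁴)²·2·(4⁴K₁‖e‖/α⁴)·(M·9⁴/α⁴)`. [folklore] -/
theorem floor_transfer (β : ℝ) (L : ℕ) {C : ℝ} {R : ℕ}
    (H : ∀ (n : ℕ) (x : Fin n → (Fin 4 → ℤ)),
      (∀ i j : Fin n, i ≠ j → ∃ k : Fin 4,
        (2 * (R : ℤ) + 4) ≤ |((((x i k - x j k : ℤ) : ZMod (2 * L + 1))).valMinAbs : ℤ)|) →
      |torusE G r β L (fun U => ∏ i, (dens G r (x i) U - torusE G r β L (dens G r (x i))))| ≤ (C / (R : ℝ) ^ 4) ^ n)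
    {α δ M K₁ : ℝ} (hα : 0 < α) (hα1 : α ≤ 1) (hσL : 2 * (3 : ℝ) ≤ α * L) (hRδ : ((R : ℝ) + 2) * α ≤ δ)
    (v u : 𝓢(EuclideanSpace ℝ (Fin 4), ℝ)) (e : EuclideanSpace ℝ (Fin 4)) (he : ‖e‖ ≤ 1)
    (hu : ∀ y, u y = v (y + e))
    (gap_u : ∀ p : EuclideanSpace ℝ (Fin 4), u p ≠ 0 → δ ≤ p 0)
    (gap_v : ∀ p : EuclideanSpace ℝ (Fin 4), v p ≠ 0 → δ ≤ p 0)
    (ball_u : tsupport (u : EuclideanSpace ℝ (Fin 4) → ℝ) ⊆ Metric.closedBall 0 3)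
    (ball_v : tsupport (v : EuclideanSpace ℝ (Fin 4) → ℝ) ⊆ Metric.closedBall 0 3)
    (hM : ∀ y, |v y| ≤ M)
    (hK₁ : ∀ (z e' : EuclideanSpace ℝ (Fin 4)), ‖e'‖ ≤ 1 → |v (z + e') - v z| ≤ K₁ * ‖e'‖ * ((1 + ‖z‖) ^ 8)⁻¹) :
    |Q2 G r β L α (thetaTest 4 u) u - Q2 G r β L α (thetaTest 4 v) v| ≤
      (C / (R : ℝ) ^ 4) ^ 2 * (2 * ((4 ^ 4 * K₁ * ‖e‖ / α ^ 4) * (M * (2 * 3 + 3) ^ 4 / α ^ 4))) := by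
  have hM0 : 0 ≤ M := (abs_nonneg _).trans (hM 0)
  have hMu : ∀ y, |u y| ≤ M := fun y => by rw [hu]; exact hM _
  have hMθv : ∀ y, |thetaTest 4 v y| ≤ M := fun y => by rw [thetaTest_apply]; exact hM _
  have hmod := modulus_bound G r β L H hα hσL hRδ (thetaTest 4 u) (thetaTest 4 v) u v
    (theta_gap gap_u) (theta_gap gap_v) gap_u gap_v
    (tsupport_thetaTest_subset_closedBall_zero ball_u) (tsupport_thetaTest_subset_closedBall_zero ball_v) ball_u ball_v
  have Su : ∑ x ∈ box 4 L, |u (α • siteToE x)| ≤ M * (2 * 3 + 3) ^ 4 / α ^ 4 :=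
    sum_abs_lattice_le_sup_div hMu ball_u (by norm_num) hα hα1 _
  have Sθv : ∑ x ∈ box 4 L, |thetaTest 4 v (α • siteToE x)| ≤ M * (2 * 3 + 3) ^ 4 / α ^ 4 :=
    sum_abs_lattice_le_sup_div hMθv (tsupport_thetaTest_subset_closedBall_zero ball_v) (by norm_num) hα hα1 _
  have Duv : ∑ x ∈ box 4 L, |u (α • siteToE x) - v (α • siteToE x)| ≤ 4 ^ 4 * K₁ * ‖e‖ / α ^ 4 := by
    simp only [hu]
    exact sum_abs_sub_shift_le hK₁ L hα hα1 he
  have Dθuv : ∑ x ∈ box 4 L, |thetaTest 4 u (α • siteToE x) - thetaTest 4 v (α • siteToE x)| ≤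
      4 ^ 4 * K₁ * ‖e‖ / α ^ 4 := by
    simp only [thetaTest_apply, hu]
    exact sum_abs_sub_shift_theta_le hK₁ L hα hα1 he
  have hS0 : ∀ f : EuclideanSpace ℝ (Fin 4) → ℝ, 0 ≤ ∑ x ∈ box 4 L, |f (α • siteToE x)| :=
    fun f => Finset.sum_nonneg fun _ _ => abs_nonneg _
  have hA0 : 0 ≤ 4 ^ 4 * K₁ * ‖e‖ / α ^ 4 := (Finset.sum_nonneg fun _ _ => abs_nonneg _).trans Duv
  have hB0 : 0 ≤ M * (2 * 3 + 3) ^ 4 / α ^ 4 := by positivity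
  have h1 : (∑ x ∈ box 4 L, |thetaTest 4 u (α • siteToE x) - thetaTest 4 v (α • siteToE x)|) *
      (∑ y ∈ box 4 L, |u (α • siteToE y)|) ≤ (4 ^ 4 * K₁ * ‖e‖ / α ^ 4) * (M * (2 * 3 + 3) ^ 4 / α ^ 4) :=
    mul_le_mul Dθuv Su (hS0 _) hA0
  have h2 : (∑ x ∈ box 4 L, |thetaTest 4 v (α • siteToE x)|) *
      (∑ y ∈ box 4 L, |u (α • siteToE y) - v (α • siteToE y)|) ≤ (M * (2 * 3 + 3) ^ 4 / α ^ 4) * (4 ^ 4 * K₁ * ‖e‖ / α ^ 4) :=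
    mul_le_mul Sθv Duv (Finset.sum_nonneg fun _ _ => abs_nonneg _) hB0
  refine hmod.trans (mul_le_mul_of_nonneg_left ?_ (sq_nonneg _))
  calc (∑ x ∈ box 4 L, |thetaTest 4 u (α • siteToE x) - thetaTest 4 v (α • siteToE x)|) *
          (∑ y ∈ box 4 L, |u (α • siteToE y)|) +
        (∑ x ∈ box 4 L, |thetaTest 4 v (α • siteToE x)|) *
          (∑ y ∈ box 4 L, |u (α • siteToE y) - v (α • siteToE y)|)
      ≤ (4 ^ 4 * K₁ * ‖e‖ / α ^ 4) * (M * (2 * 3 + 3) ^ 4 / α ^ 4) +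
          (M * (2 * 3 + 3) ^ 4 / α ^ 4) * (4 ^ 4 * K₁ * ‖e‖ / α ^ 4) := add_le_add h1 h2
    _ = 2 * ((4 ^ 4 * K₁ * ‖e‖ / α ^ 4) * (M * (2 * 3 + 3) ^ 4 / α ^ 4)) := by ring

/-- **Ceiling at one coupling.**  Under the `n`-point collar bound at `(β, L, R)` with constant `C`, for a test function `f` with time gap
`δ` supported in the ball of radius `3` with sup bound `M`, at spacing `0 < α ≤ 1` with `6 ≤ αL`, `(R+2)α ≤ δ`:
`Q2(θf, f) ≤ (M·9⁴/α⁴)²·(C/R⁴)²`. [folklore] -/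
theorem ceiling_transfer (β : ℝ) (L : ℕ) {C : ℝ} {R : ℕ}
    (H : ∀ (n : ℕ) (x : Fin n → (Fin 4 → ℤ)),
      (∀ i j : Fin n, i ≠ j → ∃ k : Fin 4,
        (2 * (R : ℤ) + 4) ≤ |((((x i k - x j k : ℤ) : ZMod (2 * L + 1))).valMinAbs : ℤ)|) →
      |torusE G r β L (fun U => ∏ i, (dens G r (x i) U - torusE G r β L (dens G r (x i))))| ≤ (C / (R : ℝ) ^ 4) ^ n)
    {α δ M : ℝ} (hα : 0 < α) (hα1 : α ≤ 1) (hσL : 2 * (3 : ℝ) ≤ α * L) (hRδ : ((R : ℝ) + 2) * α ≤ δ)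
    (f : 𝓢(EuclideanSpace ℝ (Fin 4), ℝ))
    (gap_f : ∀ p : EuclideanSpace ℝ (Fin 4), f p ≠ 0 → δ ≤ p 0)
    (ball_f : tsupport (f : EuclideanSpace ℝ (Fin 4) → ℝ) ⊆ Metric.closedBall 0 3) (hM : ∀ y, |f y| ≤ M) :
    Q2 G r β L α (thetaTest 4 f) f ≤ (M * (2 * 3 + 3) ^ 4 / α ^ 4) * (M * (2 * 3 + 3) ^ 4 / α ^ 4) * (C / (R : ℝ) ^ 4) ^ 2 := by
  have hM0 : 0 ≤ M := (abs_nonneg _).trans (hM 0)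
  have hMθ : ∀ y, |thetaTest 4 f y| ≤ M := fun y => by rw [thetaTest_apply]; exact hM _
  have h := ceiling_bound G r β L H hα hσL hRδ (thetaTest 4 f) f (theta_gap gap_f) gap_f
    (tsupport_thetaTest_subset_closedBall_zero ball_f) ball_f
  have Sf : ∑ x ∈ box 4 L, |f (α • siteToE x)| ≤ M * (2 * 3 + 3) ^ 4 / α ^ 4 :=
    sum_abs_lattice_le_sup_div hM ball_f (by norm_num) hα hα1 _
  have Sθ : ∑ x ∈ box 4 L, |thetaTest 4 f (α • siteToE x)| ≤ M * (2 * 3 + 3) ^ 4 / α ^ 4 :=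
    sum_abs_lattice_le_sup_div hMθ (tsupport_thetaTest_subset_closedBall_zero ball_f) (by norm_num) hα hα1 _
  refine (le_abs_self _).trans (h.trans ?_)
  exact mul_le_mul_of_nonneg_right
    (mul_le_mul Sθ Sf (Finset.sum_nonneg fun _ _ => abs_nonneg _) (by positivity)) (sq_nonneg _)

end Torus

end Summit.QuantumFields.YangMills.Theorems.MirrorDescentPrep

end
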